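import Mathlib
import Literature.NumberTheory.LFunctions.Zhang2022.TypedSection12C
import Literature.NumberTheory.LFunctions.Zhang2022.Section12Lemma121Ranges
import Literature.NumberTheory.LFunctions.Zhang2022.Section12Ded1217Sizes
import Literature.NumberTheory.LFunctions.Zhang2022.Section10CRanges1422
import Literature.NumberTheory.LFunctions.Zhang2022.SkeletonLemma84Rel
import HarnessLib

/-!
# Zhang (2022) §12 p. 73: the low range `dr ≤ P″₁` of `S_j(𝐚₁₅,𝐚₂₂)` is `o(α)` — the leaf
# `Typed.Sec12C.Low1522` as an edge from the relative Lemma 8.4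

Topic `Literature/NumberTheory/LFunctions/Zhang2022` (Landau–Siegel audit tree; verdict-neutral).
Y. Zhang, *Discrete mean estimates and the Landau–Siegel zero*, arXiv:2211.02515v1 (2022)
[Zhang2022LandauSiegel] — **an unrefereed manuscript under adjudication; this theorem-only file proves
one typed CLAIM node of its §12 from another typed node and asserts nothing about its Theorems 1–2 or
about Landau–Siegel zeros** (lane ZHANG-L, seat zl-w12-p6; leaf `hLow` of
`Skeleton.theorem1_of_leaves_v19`).

The node (p. 73, tex L3688, evaluation of `Θ₁(𝐚₁₅,𝐚₂₂)`): "The sum is split into two sums according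
to `dr ≤ P″₁` and `P″₁ < dr < P₂`. By lemma 8.2, 8.3 and 12.1, the first sum contributes `o(α)`" — typed
by L3-t9 as `Typed.Sec12C.Low1522 c′` (`‖SjOn c′ D j 𝐚₁₅ 𝐚₂₂ (dr ≤ P″₁)‖ ≤ εα` for all large `D` under
(A)). PROVED HERE as the edge

* `low1522_of_lemma84Rel : Skeleton.Lemma84Rel c′ → Typed.Sec12C.Low1522 c′` (every real `c′`), and
  `low1522_of_lemma84 : Skeleton.Lemma84 c′ → Low1522 c′` (the printed absolute Lemma 8.4 a fortiori).

In `theorem1_of_leaves_v19` the relative Lemma 8.4 is derived inside the chain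
(`h84 : Lemma84Rel c′ := lemma84Rel_of_lemma83Rel h83`, `h83 ⇐` the two App. A leaves), so the
hypothesis `hLow` can be dropped by the skeleton pen (`have hLow := Typed.Sec12C.low1522_of_lemma84Rel c′ h84`).

## The argument (the §10 template `Section10cLowRange`, with Lemma 12.1 in place of Lemma 10.1)

After the substitution `n = dr` (`Skeleton.sum_box_ite_eq_sum_divisors`) the `(d,r)`-term of `S_j` is
`|μ(r)|λ₀ⱼ(n)/(nφ(r))·M·N` with

* `M = Σ_m 𝐚₁₅(nm)m^{β_j−1} = χ(n)·Σ_l χ(l)ϰ₁₃(nl)l^{β_j−1}` (`mSum15_eq`; Lemma 12.1's sum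
  `Typed.Sec12B.sum121`): `‖M‖ ≤ T^{−1/4}` for `n ≤ P″₁/T` (`sum121_range_one`, the printed "`≪ T^{−c}`",
  Pólya–Vinogradov + partial summation) and `‖M‖ ≤ C𝓛^{2.2}𝓛⁻⁹` for `P″₁/T < n ≤ P″₁`
  (`sum121_range_two_weak'` — the DERIVABLE weak form of the printed "`≪ α₁`", campaign row G-d35-1;
  the printed strength is not needed);
* `N = Σ_n 𝐚₂₂(drn)ξ₀ⱼ(n;d,r)/n = χ(dr)·nSum22(d,r)` (`nSum22_eq_mul`; the SAME `n`-sum object as in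
  §10's `S_j(𝐚₁₄,𝐚₂₂)`, `Typed.Sec10C.nSum22`), which is `ι₃(log P₃)⁻¹S⁸·⁴(6, P₃/dr) + ι₄(log P₂)⁻¹S⁸·⁴(7, P₂/dr)`
  (`Ranges1422.nSum22_eq_S84`); for `dr ≤ P″₁` both points lie in `(T, P)`, so the relative Lemma 8.4
  (error `C𝓛⁻⁶(dr/φ(dr))²`) with `|L′(1,χ)| ≤ 4e^{9/2}𝓛²`, `|Π(d,r)| ≤ (dr/φ(dr))²`, `|𝔤_{jμ}| ≤ 146` gives
  `‖N‖ ≤ (dr/φ(dr))²·9(584e^{9/2} + C)𝓛⁻⁷` (`norm_nSum22_le_of_rel`);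
* weights: `|λ₀ⱼ(n)| ≤ (n/φ(n))⁴`, `Σ_{r∣n sqfree}φ(r)⁻¹ = n/φ(n)`, `Σ_{Y<n≤X}(n/φ(n))⁷/n ≤ e²⁵⁶(1 + log(X/Y))`
  (`Section10RangeToolkit`), so the main range weighs `≤ 3e²⁵⁶𝓛⁹` and the window (log-length `log T =
  𝓛^{1.1}`) `≤ 4e²⁵⁶𝓛²`.

Altogether `‖S_j|_{dr ≤ P″₁}‖ ≤ K e²⁵⁶(3𝓛²e^{−𝓛/4} + 4C𝓛⁻¹¹) ≤ επ𝓛⁻⁹ = εα` once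
`𝓛 ≥ max(5, 5|c′|π, Ke²⁵⁶(3·12!·4¹² + 4C)/(επ))` (`closing`). Lemma 8.2/8.3, cited in the printed
sentence, are not needed on this range (both points of Lemma 8.4 lie above `T`). No new definitions, no
named facts; standard axioms.

## References

* Y. Zhang, arXiv:2211.02515v1 (2022), §12 p. 73 (tex L3683–L3690), Lemma 12.1 p. 68, §8 Lemma 8.4
  p. 46, (8.10) p. 47, §7 Prop. 7.1 p. 33, §2 (2.6), (2.21), (2.26). [cite: Zhang2022LandauSiegel, §12 p. 73]
* R. R. Hall, G. Tenenbaum, *Divisors*, CUP 1988, §0.2. [cite: HallTenenbaum1988, §0.2]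
-/

noncomputable section

open Complex Real ComplexConjugate

namespace Literature.NumberTheory.LFunctions.Zhang2022.Typed.Sec12C

open Literature.NumberTheory.LFunctions.Zhang2022.Skeleton
open Literature.NumberTheory.LFunctions.Zhang2022.Typed.Sec10C (nSum22)
open Literature.NumberTheory.LFunctions.Zhang2022.Typed.Sec10C.Ranges1422
open Literature.NumberTheory.LFunctions.Zhang2022.Typed.Sec12B (sum121 sum121_range_one
  sum121_range_two_weak')

/-! ### Small facts -/

/-- `‖ι₃‖ ≤ 1.25`, `‖ι₄‖ ≤ 2.3` (`ι₃ = −1.00635 − 0.22789i`, `ι₄ = −0.68738 + 1.60688i`, (2.26)).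
[cite: Zhang2022LandauSiegel, §2 (2.26)] -/
private theorem norm_iota34_le' : ‖iota3‖ ≤ 1.25 ∧ ‖iota4‖ ≤ 2.3 := by
  constructor
  · rw [iota3]
    refine (norm_sub_le _ _).trans ?_
    rw [norm_mul, Complex.norm_I, mul_one, norm_neg]
    have h1 : ‖(1.00635 : ℂ)‖ = 1.00635 := by
      rw [show (1.00635 : ℂ) = ((1.00635 : ℝ) : ℂ) by norm_num, Complex.norm_real, Real.norm_of_nonneg]
      norm_num
    have h2 : ‖(0.22789 : ℂ)‖ = 0.22789 := by
      rw [show (0.22789 : ℂ) = ((0.22789 : ℝ) : ℂ) by norm_num, Complex.norm_real, Real.norm_of_nonneg]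
      norm_num
    rw [h1, h2]; norm_num
  · rw [iota4]
    refine (norm_add_le _ _).trans ?_
    rw [norm_mul, Complex.norm_I, mul_one, norm_neg]
    have h1 : ‖(0.68738 : ℂ)‖ = 0.68738 := by
      rw [show (0.68738 : ℂ) = ((0.68738 : ℝ) : ℂ) by norm_num, Complex.norm_real, Real.norm_of_nonneg]
      norm_num
    have h2 : ‖(1.60688 : ℂ)‖ = 1.60688 := by
      rw [show (1.60688 : ℂ) = ((1.60688 : ℝ) : ℂ) by norm_num, Complex.norm_real, Real.norm_of_nonneg]
      norm_num
    rw [h1, h2]; norm_num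

/-- `‖ι₃‖/log P₃ + ‖ι₄‖/log P₂ ≤ 9𝓛⁻⁹` for `𝓛 ≥ 3` (`log P₃ = 0.498𝓛⁹`, `log P₂ ≥ 0.4𝓛⁹`).
[cite: Zhang2022LandauSiegel, §2 (2.21), (2.26)] -/
private theorem iota_over_logs_le {D : ℕ} (hℓ : 3 ≤ ell D) :
    ‖iota3‖ / Real.log (Skeleton.P3 D) + ‖iota4‖ / Real.log (Skeleton.P2 D) ≤ 9 / ell D ^ 9 := by
  have h0 : 0 < ell D := by linarith
  have h9 : 0 < ell D ^ 9 := by positivity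
  obtain ⟨h3, h4⟩ := norm_iota34_le'
  have hP3 : Real.log (Skeleton.P3 D) = 0.498 * ell D ^ 9 := log_P3_eq D
  have hP2 : 0.4 * ell D ^ 9 ≤ Real.log (Skeleton.P2 D) := (log_P2_bounds (D := D) hℓ).1
  have e3 : ‖iota3‖ / Real.log (Skeleton.P3 D) ≤ 1.25 / (0.498 * ell D ^ 9) := by
    rw [hP3]; exact div_le_div_of_nonneg_right h3 (by positivity)
  have e4 : ‖iota4‖ / Real.log (Skeleton.P2 D) ≤ 2.3 / (0.4 * ell D ^ 9) :=
    div_le_div₀ (by norm_num) h4 (by positivity) hP2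
  calc ‖iota3‖ / Real.log (Skeleton.P3 D) + ‖iota4‖ / Real.log (Skeleton.P2 D)
      ≤ 1.25 / (0.498 * ell D ^ 9) + 2.3 / (0.4 * ell D ^ 9) := add_le_add e3 e4
    _ = (1.25 / 0.498 + 2.3 / 0.4) / ell D ^ 9 := by field_simp
    _ ≤ 9 / ell D ^ 9 := div_le_div_of_nonneg_right (by norm_num) h9.le

/-! ### The `n`-sum of `S_j(𝐚₁₅,𝐚₂₂)` under the relative Lemma 8.4 -/

section NSum

variable (c' : ℝ) {D : ℕ} [NeZero D] (χ : DirichletCharacter ℂ D)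

/-- **Size of the `n`-sum `Σ_n χ(n)(ι₃ϰ̄₃(drn) + ι₄ϰ̄₂(drn))ξ₀ⱼ(n;d,r)/n`** (`= Sec10C.nSum22`, the same
object as in §10's `S_j(𝐚₁₄,𝐚₂₂)`): if the two Lemma 8.4 approximations at `(μ, x) = (6, P₃/(dr))`,
`(7, P₂/(dr))` hold with the RELATIVE error `C𝓛⁻⁶(dr/φ(dr))²` (`Skeleton.Lemma84Rel`), then
`‖nSum22‖ ≤ (dr/φ(dr))²·9(584e^{9/2} + C)𝓛⁻⁷` (`|L′(1,χ)| ≤ 4e^{9/2}𝓛²`, `|Π(d,r)| ≤ (dr/φ(dr))²`,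
`‖G‖ ≤ 146(‖ι₃‖/log P₃ + ‖ι₄‖/log P₂)`, `‖ι₃‖/log P₃ + ‖ι₄‖/log P₂ ≤ 9𝓛⁻⁹`).
[cite: Zhang2022LandauSiegel, §12 p. 73; §8 Lemma 8.4 p. 46] -/
theorem norm_nSum22_le_of_rel (hℓ : 3 ≤ ell D) (hp : χ.IsPrimitive)
    (hc5 : 5 * |c'| * alpha D * ell D ≤ 1) {C : ℝ} (hC : 0 ≤ C) (j : ℕ) {d r : ℕ} (hd : 1 ≤ d)
    (hr : 1 ≤ r) (hdrP : ((d * r : ℕ) : ℝ) ≤ bigP D)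
    (h6 : ‖(∑ n ∈ Finset.Ico 1 ⌈Skeleton.P3 D / ((d * r : ℕ) : ℝ)⌉₊,
            χ (n : ZMod D) * xiZero c' D j n d r / (n : ℂ) *
              ((Skeleton.P3 D / ((d * r : ℕ) : ℝ) / n : ℝ) : ℂ) ^ (-betaMu D 6) *
                (Real.log (Skeleton.P3 D / ((d * r : ℕ) : ℝ) / n) : ℂ)) -
          deriv χ.LFunction 1 * PiW χ d r * frakgW c' D j 6 (Skeleton.P3 D / ((d * r : ℕ) : ℝ))‖ ≤
        C * (ell D ^ 6)⁻¹ * (∏ q ∈ (d * r).primeFactors, (1 - (q : ℝ)⁻¹)⁻¹) ^ 2)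
    (h7 : ‖(∑ n ∈ Finset.Ico 1 ⌈Skeleton.P2 D / ((d * r : ℕ) : ℝ)⌉₊,
            χ (n : ZMod D) * xiZero c' D j n d r / (n : ℂ) *
              ((Skeleton.P2 D / ((d * r : ℕ) : ℝ) / n : ℝ) : ℂ) ^ (-betaMu D 7) *
                (Real.log (Skeleton.P2 D / ((d * r : ℕ) : ℝ) / n) : ℂ)) -
          deriv χ.LFunction 1 * PiW χ d r * frakgW c' D j 7 (Skeleton.P2 D / ((d * r : ℕ) : ℝ))‖ ≤
        C * (ell D ^ 6)⁻¹ * (∏ q ∈ (d * r).primeFactors, (1 - (q : ℝ)⁻¹)⁻¹) ^ 2) :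
    ‖nSum22 c' χ j d r‖ ≤
      ((((d * r : ℕ) : ℝ)) / Nat.totient (d * r)) ^ 2 * (9 * (584 * Real.exp (9 / 2) + C)) /
        ell D ^ 7 := by
  have h1 : 1 ≤ ell D := by linarith
  have h0 : 0 < ell D := by linarith
  have hdr0 : d * r ≠ 0 := (Nat.mul_pos hd hr).ne'
  have hdr1 : (1 : ℝ) ≤ ((d * r : ℕ) : ℝ) := by exact_mod_cast Nat.mul_pos hd hr
  set ρ : ℝ := (((d * r : ℕ) : ℝ)) / Nat.totient (d * r) with hρ
  have hρ1 : 1 ≤ ρ := one_le_self_div_totient hdr0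
  set ι : ℝ := ‖iota3‖ / Real.log (Skeleton.P3 D) + ‖iota4‖ / Real.log (Skeleton.P2 D) with hι
  have hι0 : 0 ≤ ι := by
    have := log_P2_pos (D := D) hℓ
    have : 0 < Real.log (Skeleton.P3 D) := by rw [log_P3_eq]; positivity
    positivity
  have hι9 : ι ≤ 9 / ell D ^ 9 := iota_over_logs_le hℓ
  -- the main approximation and the three size bounds
  have hmain := norm_nSum22_sub_main_le c' χ hℓ j hd hr h6 h7
  have hG := norm_G_le c' (D := D) hℓ hc5 j (m := ((d * r : ℕ) : ℝ)) hdr1 hdrP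
  have hL := norm_deriv_L_one_le χ hℓ hp
  have hPi : ‖PiW χ d r‖ ≤ ρ ^ 2 := norm_PiW_le χ (by omega) (by omega)
  set G : ℂ := iota3 * (Real.log (Skeleton.P3 D) : ℂ)⁻¹ *
      frakgW c' D j 6 (Skeleton.P3 D / ((d * r : ℕ) : ℝ)) +
    iota4 * (Real.log (Skeleton.P2 D) : ℂ)⁻¹ * frakgW c' D j 7 (Skeleton.P2 D / ((d * r : ℕ) : ℝ))
    with hGdef
  have hmt : ‖deriv χ.LFunction 1 * PiW χ d r * G‖ ≤
      4 * Real.exp (9 / 2) * ell D ^ 2 * ρ ^ 2 * (146 * ι) := by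
    rw [norm_mul, norm_mul]
    gcongr
  have htri : ‖nSum22 c' χ j d r‖ ≤ ‖deriv χ.LFunction 1 * PiW χ d r * G‖ +
      ‖nSum22 c' χ j d r - deriv χ.LFunction 1 * PiW χ d r * G‖ := norm_le_norm_add_norm_sub' _ _
  have hl6 : (ell D ^ 6)⁻¹ ≤ ell D ^ 2 := by
    have : (1 : ℝ) ≤ ell D ^ 6 := one_le_pow₀ h1
    have : (1 : ℝ) ≤ ell D ^ 2 := one_le_pow₀ h1
    exact (inv_le_one_of_one_le₀ (by assumption)).trans this
  calc ‖nSum22 c' χ j d r‖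
      ≤ 4 * Real.exp (9 / 2) * ell D ^ 2 * ρ ^ 2 * (146 * ι) + ι * (C * (ell D ^ 6)⁻¹ * ρ ^ 2) := by
        linarith [hmain, hmt, htri]
    _ = ρ ^ 2 * ι * (584 * Real.exp (9 / 2) * ell D ^ 2 + C * (ell D ^ 6)⁻¹) := by ring
    _ ≤ ρ ^ 2 * (9 / ell D ^ 9) * (584 * Real.exp (9 / 2) * ell D ^ 2 + C * ell D ^ 2) := by
        gcongr
    _ = ρ ^ 2 * (9 * (584 * Real.exp (9 / 2) + C)) / ell D ^ 7 := by
        field_simp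

end NSum

/-! ### Parameter sizes on the range `dr ≤ P″₁` (`P″₁ = P^{0.496}Dt₀`, `T = e^{𝓛^{1.1}}`) -/

section Params

variable {D : ℕ}

/-- `𝓛^{1.1} ≤ 𝓛²` and `𝓛 ≤ 𝓛^{1.1}` for `𝓛 ≥ 1`. [folklore] -/
private theorem ell_rpow_facts (h1 : 1 ≤ ell D) :
    ell D ^ (1.1 : ℝ) ≤ ell D ^ 2 ∧ ell D ≤ ell D ^ (1.1 : ℝ) := by
  constructor
  · have h : ell D ^ (1.1 : ℝ) ≤ ell D ^ (2 : ℝ) :=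
      Real.rpow_le_rpow_of_exponent_le h1 (by norm_num)
    simpa using h
  · have h : ell D ^ (1 : ℝ) ≤ ell D ^ (1.1 : ℝ) :=
      Real.rpow_le_rpow_of_exponent_le h1 (by norm_num)
    simpa using h

/-- `𝓛^{2.2} ≤ 𝓛³` for `𝓛 ≥ 1`. [folklore] -/
private theorem ell_rpow22_le (h1 : 1 ≤ ell D) : ell D ^ (2.2 : ℝ) ≤ ell D ^ 3 := by
  have h : ell D ^ (2.2 : ℝ) ≤ ell D ^ (3 : ℝ) :=
    Real.rpow_le_rpow_of_exponent_le h1 (by norm_num)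
  simpa using h

/-- `P″₁ = e^{0.496𝓛⁹}·(Dt₀)` with `1 ≤ Dt₀ ≤ e^{520𝓛}` (`𝓛 ≥ 3`). [cite: Zhang2022LandauSiegel, §12 p. 67] -/
private theorem P1pp_eq_exp_mul (D : ℕ) :
    P1pp D = Real.exp (0.496 * ell D ^ 9) * ((D : ℝ) * t0 D) := by
  rw [P1pp, bigP, ← Real.exp_mul]; ring

/-- `Dt₀ ≤ e^{520𝓛}` for `𝓛 ≥ 3`. [cite: Zhang2022LandauSiegel, §2 (2.8)] -/
private theorem Dt0_le_exp (hℓ : 3 ≤ ell D) : (D : ℝ) * t0 D ≤ Real.exp (520 * ell D) := by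
  have h := Real.exp_le_exp.mpr (log_Dt0_le (D := D) hℓ)
  rwa [Real.exp_log (Dt0_pos hℓ)] at h

/-- `log P″₁ ≤ 0.496𝓛⁹ + 520𝓛 ≤ 𝓛⁹` and `0 ≤ log P″₁` (`𝓛 ≥ 3`). [cite: Zhang2022LandauSiegel, §12 p. 67] -/
private theorem log_P1pp_bounds (hℓ : 3 ≤ ell D) :
    0 ≤ Real.log (P1pp D) ∧ Real.log (P1pp D) ≤ 0.496 * ell D ^ 9 + 520 * ell D ∧
      Real.log (P1pp D) = 0.496 * ell D ^ 9 + Real.log ((D : ℝ) * t0 D) := by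
  have h0 : 0 < ell D := by linarith
  have hDt := Dt0_pos (D := D) hℓ
  have heq : Real.log (P1pp D) = 0.496 * ell D ^ 9 + Real.log ((D : ℝ) * t0 D) := by
    rw [P1pp_eq_exp_mul, Real.log_mul (Real.exp_pos _).ne' hDt.ne', Real.log_exp]
  refine ⟨?_, ?_, heq⟩
  · rw [heq]; have := log_Dt0_nonneg (D := D) hℓ; positivity
  · rw [heq]; linarith [log_Dt0_le (D := D) hℓ]

/-- `12L² + 520L + 1 ≤ 0.002L⁹` for `L ≥ 5`. [folklore] -/
private theorem poly_aux {L : ℝ} (hL : 5 ≤ L) : 12 * L ^ 2 + 520 * L + 1 ≤ 0.002 * L ^ 9 := by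
  have hL0 : 0 ≤ L := by linarith
  have h7 : (78125 : ℝ) ≤ L ^ 7 := le_trans (by norm_num) (pow_le_pow_left₀ (by norm_num) hL 7)
  have h9 : 78125 * L ^ 2 ≤ L ^ 9 := by
    rw [show L ^ 9 = L ^ 7 * L ^ 2 by ring]
    exact mul_le_mul_of_nonneg_right h7 (by positivity)
  nlinarith

/-- On the range: `T·P″₁ < P₃`, `T·P″₁ < P₂`, `P″₁ < PT⁻²`, `P″₁ ≤ P`, `2 ≤ P″₁/T` (`𝓛 ≥ 5`).
[cite: Zhang2022LandauSiegel, §2 (2.21), §12 p. 67] -/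
private theorem range_sizes (hℓ5 : 5 ≤ ell D) :
    bigT D * P1pp D < Skeleton.P3 D ∧ bigT D * P1pp D < Skeleton.P2 D ∧
      P1pp D < bigP D / bigT D ^ 2 ∧ P1pp D ≤ bigP D ∧ 2 ≤ P1pp D / bigT D := by
  have hℓ : 3 ≤ ell D := by linarith
  have h1 : 1 ≤ ell D := by linarith
  have h0 : 0 < ell D := by linarith
  obtain ⟨h11, h1r⟩ := ell_rpow_facts h1
  have h8 : (5 : ℝ) ^ 8 ≤ ell D ^ 8 := pow_le_pow_left₀ (by norm_num) hℓ5 8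
  have h9 : ell D ^ 9 = ell D ^ 8 * ell D := by ring
  have hDt1 := Dt0_ge_one (D := D) hℓ
  have hDt := Dt0_le_exp hℓ
  have hT : bigT D = Real.exp (ell D ^ (1.1 : ℝ)) := rfl
  have hTP : bigT D * P1pp D ≤ Real.exp (ell D ^ (1.1 : ℝ) + 0.496 * ell D ^ 9 + 520 * ell D) := by
    rw [Real.exp_add, Real.exp_add, hT, P1pp_eq_exp_mul, ← mul_assoc]
    exact mul_le_mul_of_nonneg_left hDt (by positivity)
  have hpoly := poly_aux hℓ5
  have hL2 : 0 ≤ ell D ^ 2 := by positivity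
  refine ⟨?_, ?_, ?_, ?_, ?_⟩
  · refine hTP.trans_lt ?_
    rw [Skeleton.P3, bigP, ← Real.exp_mul, Real.exp_lt_exp]
    linarith
  · refine hTP.trans_lt ?_
    have : Skeleton.P2 D = Real.exp (0.5 * ell D ^ 9 - 10 * ell D ^ (1.1 : ℝ)) := by
      rw [Skeleton.P2, bigP, bigT, ← Real.exp_mul, ← Real.exp_nat_mul, ← Real.exp_sub]; ring_nf
    rw [this, Real.exp_lt_exp]
    linarith
  · have hle : P1pp D ≤ Real.exp (0.496 * ell D ^ 9 + 520 * ell D) := by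
      rw [Real.exp_add, P1pp_eq_exp_mul]
      exact mul_le_mul_of_nonneg_left hDt (by positivity)
    refine hle.trans_lt ?_
    rw [bigP, bigT, ← Real.exp_nat_mul, ← Real.exp_sub, Real.exp_lt_exp]
    push_cast
    linarith
  · have hle : P1pp D ≤ Real.exp (0.496 * ell D ^ 9 + 520 * ell D) := by
      rw [Real.exp_add, P1pp_eq_exp_mul]
      exact mul_le_mul_of_nonneg_left hDt (by positivity)
    refine hle.trans ?_
    rw [bigP, Real.exp_le_exp]
    linarith
  · rw [le_div_iff₀ (bigT_pos D), hT, P1pp_eq_exp_mul]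
    have h2 : (2 : ℝ) ≤ Real.exp 1 := by
      have := Real.add_one_le_exp (1 : ℝ); linarith
    calc 2 * Real.exp (ell D ^ (1.1 : ℝ)) ≤ Real.exp 1 * Real.exp (ell D ^ (1.1 : ℝ)) := by
          gcongr
      _ = Real.exp (1 + ell D ^ (1.1 : ℝ)) := by rw [Real.exp_add]
      _ ≤ Real.exp (0.496 * ell D ^ 9) := by rw [Real.exp_le_exp]; linarith
      _ = Real.exp (0.496 * ell D ^ 9) * 1 := (mul_one _).symm
      _ ≤ Real.exp (0.496 * ell D ^ 9) * ((D : ℝ) * t0 D) := by gcongr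

/-- `T^{−1/4} ≤ e^{−𝓛/4}` (`𝓛 ≥ 1`). [cite: Zhang2022LandauSiegel, §2 (2.6)] -/
private theorem bigT_rpow_neg_quarter_le (h1 : 1 ≤ ell D) :
    bigT D ^ (-(1 / 4 : ℝ)) ≤ Real.exp (-(ell D / 4)) := by
  rw [bigT, ← Real.exp_mul, Real.exp_le_exp]
  have := (ell_rpow_facts h1).2
  linarith

/-- `e^{−L/4}·L¹¹ ≤ 12!·4¹²/L` for `L > 0` (from `(L/4)¹²/12! ≤ e^{L/4}`). [folklore] -/
private theorem exp_neg_quarter_mul_pow_le {L : ℝ} (hL : 0 < L) :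
    Real.exp (-(L / 4)) * L ^ 11 ≤ (Nat.factorial 12 : ℝ) * 4 ^ 12 / L := by
  have hx : 0 ≤ L / 4 := by positivity
  have h := Real.pow_div_factorial_le_exp (L / 4) hx 12
  have hfac : (0 : ℝ) < Nat.factorial 12 := by positivity
  have hexp : 0 < Real.exp (L / 4) := Real.exp_pos _
  rw [Real.exp_neg]
  have hinv : (Real.exp (L / 4))⁻¹ ≤ (Nat.factorial 12 : ℝ) / (L / 4) ^ 12 := by
    rw [inv_le_comm₀ hexp (by positivity), inv_div]
    exact h
  calc (Real.exp (L / 4))⁻¹ * L ^ 11 ≤ (Nat.factorial 12 : ℝ) / (L / 4) ^ 12 * L ^ 11 := by gcongr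
    _ = (Nat.factorial 12 : ℝ) * 4 ^ 12 / L := by field_simp

/-- The closing numerical step: for `K, C ≥ 0`, `ε > 0`, `L ≥ 1` with
`K·e²⁵⁶(3·12!·4¹² + 4C)/(επ) ≤ L`: `K·e²⁵⁶(3L²e^{−L/4} + 4C·L⁻¹¹) ≤ επ/L⁹`. [folklore] -/
private theorem closing {K C ε L : ℝ} (hK : 0 ≤ K) (hC : 0 ≤ C) (hε : 0 < ε) (hL1 : 1 ≤ L)
    (hL : K * Real.exp 256 * (3 * (Nat.factorial 12 : ℝ) * 4 ^ 12 + 4 * C) / (ε * π) ≤ L) :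
    K * Real.exp 256 * (3 * L ^ 2 * Real.exp (-(L / 4)) + 4 * C * (L ^ 11)⁻¹) ≤ ε * π / L ^ 9 := by
  have hL0 : 0 < L := by linarith
  have hεπ : 0 < ε * π := by positivity
  have h1 : L ^ 2 * Real.exp (-(L / 4)) ≤ (Nat.factorial 12 : ℝ) * 4 ^ 12 / L ^ 10 := by
    have h := exp_neg_quarter_mul_pow_le hL0
    rw [le_div_iff₀ (by positivity)]
    rw [le_div_iff₀ hL0] at h
    nlinarith [h]
  have h2 : (L ^ 11)⁻¹ ≤ 1 / L ^ 10 := by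
    rw [one_div, inv_le_inv₀ (by positivity) (by positivity)]
    calc L ^ 10 = L ^ 10 * 1 := (mul_one _).symm
      _ ≤ L ^ 10 * L := by gcongr
      _ = L ^ 11 := by ring
  have hmain : K * Real.exp 256 * (3 * L ^ 2 * Real.exp (-(L / 4)) + 4 * C * (L ^ 11)⁻¹) ≤
      K * Real.exp 256 * (3 * (Nat.factorial 12 : ℝ) * 4 ^ 12 + 4 * C) / L ^ 10 := by
    calc K * Real.exp 256 * (3 * L ^ 2 * Real.exp (-(L / 4)) + 4 * C * (L ^ 11)⁻¹)
        = K * Real.exp 256 * (3 * (L ^ 2 * Real.exp (-(L / 4))) + 4 * C * (L ^ 11)⁻¹) := by ring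
      _ ≤ K * Real.exp 256 * (3 * ((Nat.factorial 12 : ℝ) * 4 ^ 12 / L ^ 10) +
            4 * C * (1 / L ^ 10)) := by gcongr
      _ = K * Real.exp 256 * (3 * (Nat.factorial 12 : ℝ) * 4 ^ 12 + 4 * C) / L ^ 10 := by
          field_simp
  refine hmain.trans ?_
  rw [div_le_div_iff₀ (by positivity) (by positivity)]
  rw [div_le_iff₀ hεπ] at hL
  have hL9 : 0 < L ^ 9 := by positivity
  calc K * Real.exp 256 * (3 * (Nat.factorial 12 : ℝ) * 4 ^ 12 + 4 * C) * L ^ 9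
      ≤ L * (ε * π) * L ^ 9 := by gcongr
    _ = ε * π * L ^ 10 := by ring

/-- `log D ≥ L` once `D ≥ ⌈e^L⌉`. [folklore] -/
private theorem le_ell_of_ceil_exp_le {L : ℝ} (hD : ⌈Real.exp L⌉₊ ≤ D) : L ≤ ell D := by
  rw [ell]
  have hexp : Real.exp L ≤ D := le_trans (Nat.le_ceil _) (by exact_mod_cast hD)
  exact (Real.le_log_iff_exp_le (lt_of_lt_of_le (Real.exp_pos _) hexp)).mpr hexp

end Params

/-! ### Weight sums `Σ (n/φ(n))⁷/n` over the main range and the window -/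

section Weights

/-- `Σ_{1 ≤ n ≤ X} (n/φ(n))⁷/n ≤ 1 + e²⁵⁶(1 + log X)` (`X ≥ 1`). [cite: HallTenenbaum1988, §0.2] -/
private theorem sum_Icc_ratio7_le {X : ℕ} (hX : 1 ≤ X) :
    ∑ n ∈ Finset.Icc 1 X, ((n : ℝ) / Nat.totient n) ^ 7 / n ≤
      1 + Real.exp 256 * (1 + Real.log X) := by
  rw [Finset.Icc_eq_cons_Ioc hX, Finset.sum_cons]
  have h1 : (((1 : ℕ) : ℝ) / Nat.totient 1) ^ 7 / ((1 : ℕ) : ℝ) = 1 := by simp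
  rw [h1]
  have h := sum_ratio_pow_div_le 7 (Y := 1) (X := X) one_pos hX
  simp only [Nat.cast_one, Real.log_one, sub_zero] at h
  have h256 : (2 : ℝ) ^ (7 + 1) = 256 := by norm_num
  rw [h256] at h
  linarith

/-- Main range: `Σ_{n ∈ F, n ≤ W} (n/φ(n))⁷/n ≤ 1 + e²⁵⁶(1 + log W)` for `W ≥ 1`, `F ⊆ [1, ∞)`.
[cite: HallTenenbaum1988, §0.2] -/
private theorem sum_main_le (F : Finset ℕ) (hF : ∀ n ∈ F, 1 ≤ n) {W : ℝ} (hW : 1 ≤ W) :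
    ∑ n ∈ F.filter (fun n : ℕ => (n : ℝ) ≤ W), ((n : ℝ) / Nat.totient n) ^ 7 / n ≤
      1 + Real.exp 256 * (1 + Real.log W) := by
  have hW1 : 1 ≤ ⌊W⌋₊ := Nat.le_floor (by exact_mod_cast hW)
  have hsub : F.filter (fun n : ℕ => (n : ℝ) ≤ W) ⊆ Finset.Icc 1 ⌊W⌋₊ := by
    intro n hn
    rw [Finset.mem_filter] at hn
    rw [Finset.mem_Icc]
    exact ⟨hF n hn.1, Nat.le_floor hn.2⟩
  calc ∑ n ∈ F.filter (fun n : ℕ => (n : ℝ) ≤ W), ((n : ℝ) / Nat.totient n) ^ 7 / n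
      ≤ ∑ n ∈ Finset.Icc 1 ⌊W⌋₊, ((n : ℝ) / Nat.totient n) ^ 7 / n :=
        Finset.sum_le_sum_of_subset_of_nonneg hsub fun n _ _ => by positivity
    _ ≤ 1 + Real.exp 256 * (1 + Real.log (⌊W⌋₊ : ℕ)) := sum_Icc_ratio7_le hW1
    _ ≤ 1 + Real.exp 256 * (1 + Real.log W) := by
        gcongr
        exact Nat.floor_le (by linarith)

/-- Window: `Σ_{n ∈ F, n > W} (n/φ(n))⁷/n ≤ e²⁵⁶(3 + log V − log W)` for `2 ≤ W ≤ V`, `F ⊆ [0, V]`.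
[cite: HallTenenbaum1988, §0.2] -/
private theorem sum_window_le (F : Finset ℕ) {W V : ℝ} (hW : 2 ≤ W) (hWV : W ≤ V)
    (hF : ∀ n ∈ F, (n : ℝ) ≤ V) :
    ∑ n ∈ F.filter (fun n : ℕ => ¬ (n : ℝ) ≤ W), ((n : ℝ) / Nat.totient n) ^ 7 / n ≤
      Real.exp 256 * (3 + Real.log V - Real.log W) := by
  have hsub : F.filter (fun n : ℕ => ¬ (n : ℝ) ≤ W) ⊆ Finset.Ioc (⌈W⌉₊ - 1) ⌈V⌉₊ := by
    intro n hn
    rw [Finset.mem_filter] at hn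
    rw [Finset.mem_Ioc]
    constructor
    · have h1 : W ≤ n := (not_le.mp hn.2).le
      have h2 : ⌈W⌉₊ ≤ n := Nat.ceil_le.mpr h1
      have h3 : 1 ≤ ⌈W⌉₊ := Nat.one_le_iff_ne_zero.mpr (by
        intro h0; rw [Nat.ceil_eq_zero] at h0; linarith)
      omega
    · have : (n : ℝ) ≤ ⌈V⌉₊ := (hF n hn.1).trans (Nat.le_ceil V)
      exact_mod_cast this
  calc ∑ n ∈ F.filter (fun n : ℕ => ¬ (n : ℝ) ≤ W), ((n : ℝ) / Nat.totient n) ^ 7 / n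
      ≤ ∑ n ∈ Finset.Ioc (⌈W⌉₊ - 1) ⌈V⌉₊, ((n : ℝ) / Nat.totient n) ^ 7 / n :=
        Finset.sum_le_sum_of_subset_of_nonneg hsub fun n _ _ => by positivity
    _ ≤ _ := sum_ratio7_window_le hW hWV

end Weights

/-! ### The two inner sums of `S_j(𝐚₁₅,𝐚₂₂)` and the per-`(d,r)` term -/

section Terms

variable (c' : ℝ) {D : ℕ} (χ : DirichletCharacter ℂ D)

/-- A real (quadratic) character is fixed by complex conjugation. [folklore] -/
private theorem conj_chi_of_isQuadratic (hq : χ.IsQuadratic) (a : ZMod D) : conj (χ a) = χ a := by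
  rcases hq a with h | h | h <;> simp [h]

/-- **The `m`-sum of `S_j(𝐚₁₅,𝐚₂₂)` at `dr = n` is `χ(n)·Σ_l χ(l)ϰ₁₃(nl)l^{β_j−1}`** — Lemma 12.1's sum
`Typed.Sec12B.sum121` at `d := n` (`𝐚₁₅(nm) = χ(n)χ(m)ϰ₁₃(nm)`; the truncations `⌈PT⁻²⌉` of `S_j` and
`⌈P″₂⌉` of `sum121` agree since `ϰ₁₃` vanishes from `P″₂ ≤ PT⁻²` on). [cite: Zhang2022LandauSiegel, §12 p. 73, tex L3683] -/
theorem mSum15_eq (hD : 3 ≤ Real.log D) (j : ℕ) {a15 : ℕ → ℂ}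
    (ha15 : ∀ n, a15 n = χ (n : ZMod D) * vk13 D n) {n : ℕ} (hn : 1 ≤ n) :
    ∑ m ∈ Finset.Ico 1 (Nsupp D), a15 (n * m) / (m : ℂ) ^ (1 - betaJ c' D j) =
      χ (n : ZMod D) * sum121 c' χ j n := by
  rw [sum121, Finset.mul_sum]
  have hsub : Finset.Ico 1 ⌈P2pp D⌉₊ ⊆ Finset.Ico 1 (Nsupp D) :=
    Finset.Ico_subset_Ico_right (Sec12D.ceil_P2pp_le_Nsupp hD)
  have hz : ∀ m ∈ Finset.Ico 1 (Nsupp D), m ∉ Finset.Ico 1 ⌈P2pp D⌉₊ →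
      χ (n : ZMod D) * (χ (m : ZMod D) * vk13 D (n * m) / (m : ℂ) ^ (1 - betaJ c' D j)) = 0 := by
    intro m hm hm'
    rw [Finset.mem_Ico] at hm
    have hmP : ⌈P2pp D⌉₊ ≤ m := by
      by_contra h
      exact hm' (Finset.mem_Ico.mpr ⟨hm.1, not_le.mp h⟩)
    have hle : P2pp D ≤ ((n * m : ℕ) : ℝ) := by
      have h1 : P2pp D ≤ m := (Nat.le_ceil _).trans (by exact_mod_cast hmP)
      refine h1.trans ?_
      exact_mod_cast Nat.le_mul_of_pos_left m hn
    rw [Sec12D.vk13_eq_zero_of_le hle]; simp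
  rw [Finset.sum_subset hsub hz]
  refine Finset.sum_congr rfl fun m _ => ?_
  rw [ha15]; push_cast; rw [map_mul]; ring

/-- **The `n`-sum of `S_j(𝐚₁₅,𝐚₂₂)` at `(d,r)` is `χ(dr)·nSum22(d,r)`** (`𝐚₂₂(drn) = χ(drn)(ι₃ϰ̄₃(drn) + ι₄ϰ̄₂(drn))`
for the real character `χ`; `nSum22` = the `n`-sum object of §10's `S_j(𝐚₁₄,𝐚₂₂)`, same sequence `𝐚₂₂`).
[cite: Zhang2022LandauSiegel, §12 p. 73, tex L3683] -/
theorem nSum22_eq_mul (hq : χ.IsQuadratic) (j d r : ℕ) :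
    ∑ n ∈ Finset.Ico 1 (Nsupp D), a22 χ (d * r * n) * xiZero c' D j n d r / (n : ℂ) =
      χ ((d * r : ℕ) : ZMod D) * nSum22 c' χ j d r := by
  rw [nSum22, Finset.mul_sum]
  refine Finset.sum_congr rfl fun n _ => ?_
  simp only [a22, a12, Nat.cast_mul, map_mul, map_add, Complex.conj_conj,
    conj_chi_of_isQuadratic χ hq]
  ring

/-- `‖|μ(r)|‖ = [r squarefree]` (as a complex-cast natural number). [folklore] -/
private theorem norm_natAbs_moebius (r : ℕ) :
    ‖((ArithmeticFunction.moebius r).natAbs : ℂ)‖ = if Squarefree r then 1 else 0 := by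
  rw [Complex.norm_natCast]
  split_ifs with h
  · rw [ArithmeticFunction.moebius_apply_of_squarefree h]; simp [Int.natAbs_pow]
  · rw [ArithmeticFunction.moebius_eq_zero_of_not_squarefree h]; simp

/-- **Per-term bound.** For `n = dr ≥ 1`, `r ∣ n`: the `(d,r)`-term of `S_j` has modulus
`≤ [r sqfree]φ(r)⁻¹·(n/φ(n))⁴n⁻¹·M·N` whenever `‖m-sum‖ ≤ M`, `‖n-sum‖ ≤ N` (`‖λ₀ⱼ(n)‖ ≤ (n/φ(n))⁴`).
[cite: Zhang2022LandauSiegel, §12 p. 73; §7 Prop. 7.1 p. 33] -/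
private theorem norm_term_le (j : ℕ) {n r : ℕ} (hn : n ≠ 0) (hrn : r ∣ n) (Mf Nf : ℂ)
    {Mv Nv : ℝ} (hM : ‖Mf‖ ≤ Mv) (hN : ‖Nf‖ ≤ Nv) (hMv : 0 ≤ Mv) :
    ‖((ArithmeticFunction.moebius r).natAbs : ℂ) * lamZero c' D j (n / r * r) /
          (((n / r * r : ℕ) : ℂ) * (Nat.totient r : ℂ)) * Mf * Nf‖ ≤
      (if Squarefree r then 1 / (Nat.totient r : ℝ) else 0) *
        (((n : ℝ) / Nat.totient n) ^ 4 / n) * Mv * Nv := by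
  have hr0 : r ≠ 0 := by rintro rfl; simp at hrn; exact hn hrn
  have hdr : n / r * r = n := Nat.div_mul_cancel hrn
  rw [hdr]
  have hn0 : (0 : ℝ) < n := by exact_mod_cast Nat.pos_of_ne_zero hn
  have hφr : (0 : ℝ) < Nat.totient r := by
    exact_mod_cast Nat.totient_pos.mpr (Nat.pos_of_ne_zero hr0)
  have hNv : 0 ≤ Nv := (norm_nonneg _).trans hN
  have hlam := norm_lamZero_le c' D j hn
  rw [norm_mul, norm_mul, norm_div, norm_mul, norm_natAbs_moebius, norm_mul, Complex.norm_natCast,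
    Complex.norm_natCast]
  split_ifs with hsq
  · calc 1 * ‖lamZero c' D j n‖ / ((n : ℝ) * Nat.totient r) * ‖Mf‖ * ‖Nf‖
        ≤ 1 * ((n : ℝ) / Nat.totient n) ^ 4 / ((n : ℝ) * Nat.totient r) * Mv * Nv := by gcongr
      _ = 1 / (Nat.totient r : ℝ) * ((((n : ℝ) / Nat.totient n) ^ 4) / n) * Mv * Nv := by
          field_simp
  · simp

/-- **Per-`n` bound**: summing the per-term bound over `r ∣ n` with `Σ_{r∣n, r sqfree} φ(r)⁻¹ = n/φ(n)`
gives `≤ (n/φ(n))⁷n⁻¹·M·K` when `‖m-sum‖ ≤ M` and `‖n-sum‖ ≤ (n/φ(n))²K`.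
[cite: Zhang2022LandauSiegel, §12 p. 73; §8 (8.10) p. 47] -/
private theorem sum_divisors_norm_term_le (j : ℕ) {n : ℕ} (hn : n ≠ 0) (Mf Nf : ℕ → ℂ)
    {Mv K : ℝ} (hMv : 0 ≤ Mv) (hM : ∀ r ∈ n.divisors, ‖Mf r‖ ≤ Mv)
    (hN : ∀ r ∈ n.divisors, ‖Nf r‖ ≤ ((n : ℝ) / Nat.totient n) ^ 2 * K) :
    ∑ r ∈ n.divisors, ‖((ArithmeticFunction.moebius r).natAbs : ℂ) * lamZero c' D j (n / r * r) /
          (((n / r * r : ℕ) : ℂ) * (Nat.totient r : ℂ)) * Mf r * Nf r‖ ≤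
      ((n : ℝ) / Nat.totient n) ^ 7 / n * Mv * K := by
  have hn0 : (0 : ℝ) < n := by exact_mod_cast Nat.pos_of_ne_zero hn
  calc ∑ r ∈ n.divisors, ‖((ArithmeticFunction.moebius r).natAbs : ℂ) * lamZero c' D j (n / r * r) /
          (((n / r * r : ℕ) : ℂ) * (Nat.totient r : ℂ)) * Mf r * Nf r‖
      ≤ ∑ r ∈ n.divisors, (if Squarefree r then 1 / (Nat.totient r : ℝ) else 0) *
          ((((n : ℝ) / Nat.totient n) ^ 4) / n) * Mv * (((n : ℝ) / Nat.totient n) ^ 2 * K) :=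
        Finset.sum_le_sum fun r hr =>
          norm_term_le c' j hn (Nat.dvd_of_mem_divisors hr) (Mf r) (Nf r) (hM r hr) (hN r hr) hMv
    _ = (∑ r ∈ n.divisors with Squarefree r, (1 / (Nat.totient r : ℝ))) *
          (((((n : ℝ) / Nat.totient n) ^ 4) / n) * Mv * (((n : ℝ) / Nat.totient n) ^ 2 * K)) := by
        rw [Finset.sum_filter, Finset.sum_mul]
        refine Finset.sum_congr rfl fun r _ => ?_
        split_ifs <;> ring
    _ = ((n : ℝ) / Nat.totient n) ^ 7 / n * Mv * K := by
        rw [sum_sqfree_divisors_inv_totient hn]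
        ring

open scoped Classical in
/-- The reindexed range sum: `S_j(𝐚₁₅,𝐚₂₂)|_{dr ≤ P″₁} = Σ_{n ≤ P″₁} Σ_{r∣n} term(n/r, r)` (the
substitution `n = dr`, `Skeleton.sum_box_ite_eq_sum_divisors`). [cite: Zhang2022LandauSiegel, §8 p. 48] -/
private theorem SjOn_bot_eq (j : ℕ) (a15 : ℕ → ℂ) (hpN : ∀ n, rngBot D n → n < Nsupp D) :
    SjOn c' D j a15 (a22 χ) (rngBot D) =
      ∑ n ∈ (Finset.Ico 1 (Nsupp D)).filter (fun n => rngBot D n), ∑ r ∈ n.divisors,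
        ((ArithmeticFunction.moebius r).natAbs : ℂ) * lamZero c' D j (n / r * r) /
            (((n / r * r : ℕ) : ℂ) * (Nat.totient r : ℂ)) *
          (∑ m ∈ Finset.Ico 1 (Nsupp D), a15 (n / r * r * m) / (m : ℂ) ^ (1 - betaJ c' D j)) *
          (∑ n' ∈ Finset.Ico 1 (Nsupp D),
            a22 χ (n / r * r * n') * xiZero c' D j n' (n / r) r / (n' : ℂ)) := by
  classical
  unfold SjOn
  exact sum_box_ite_eq_sum_divisors (Nsupp D) (rngBot D) hpN _

end Terms

/-! ### The edge theorem: `Lemma84Rel c′ → Low1522 c′` -/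

section Main

/-- **Z22 §12 p. 73 (tex L3688), first range claim of the evaluation of `Θ₁(𝐚₁₅,𝐚₂₂)`, as an EDGE
THEOREM from Lemma 8.4 in its relative form**: "The sum is split into two sums according to `dr ≤ P″₁`
and `P″₁ < dr < P₂`. By lemma 8.2, 8.3 and 12.1, the first sum contributes `o(α)`" — for every real `c′`,
`Skeleton.Lemma84Rel c′ → Typed.Sec12C.Low1522 c′`. Quantitatively: after `n = dr`, the `m`-sum is
`χ(n)Σ_l χ(l)ϰ₁₃(nl)l^{β_j−1}` (Lemma 12.1's sum), of modulus `≤ T^{−1/4}` for `n ≤ P″₁/T`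
(`Typed.Sec12B.sum121_range_one`, Pólya–Vinogradov) and `≤ C𝓛^{2.2}𝓛⁻⁹` on the window `P″₁/T < n ≤ P″₁`
(`sum121_range_two_weak'`, the derivable weak form of the printed "`≪ α₁`", GAP row G-d35-1); the
`n`-sum is `χ(n)·nSum22`, of modulus `≤ (n/φ(n))²K𝓛⁻⁷` by Lemma 8.4 (relative) at `x = P₃/n, P₂/n ∈ (T, P)`
with `|L′(1,χ)| ≪ 𝓛²`; the weights `|μ(r)||λ₀ⱼ(n)|/(nφ(r))` sum to `≪ Σ(n/φ(n))⁷/n ≪ 1 + log-length`;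
so the range is `≪ e^{−𝓛/4}𝓛² + 𝓛^{2.2−9−7}(3 + 𝓛^{1.1}) = O(𝓛^{−12.7}) = o(𝓛⁻⁹) = o(α)`. In
`Skeleton.theorem1_of_leaves_v19` the hypothesis `h84 : Lemma84Rel c′` is derived inside the chain
(`lemma84Rel_of_lemma83Rel`), so this edge lets the leaf `hLow` be dropped.
[cite: Zhang2022LandauSiegel, §12 p. 73, tex L3688] -/
theorem low1522_of_lemma84Rel (c' : ℝ) (h84 : Lemma84Rel c') : Low1522 c' := by
  intro ε hε
  obtain ⟨C84, D84, H84⟩ := h84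
  obtain ⟨D₁, H1⟩ := sum121_range_one c'
  obtain ⟨C2, D₂, H2⟩ := sum121_range_two_weak' c'
  -- constants
  obtain ⟨C84', hC84'⟩ : ∃ C : ℝ, C = max C84 0 := ⟨_, rfl⟩
  have hC84'0 : 0 ≤ C84' := by rw [hC84']; exact le_max_right _ _
  have hC84le : C84 ≤ C84' := by rw [hC84']; exact le_max_left _ _
  obtain ⟨C2', hC2'⟩ : ∃ C : ℝ, C = max C2 0 := ⟨_, rfl⟩
  have hC2'0 : 0 ≤ C2' := by rw [hC2']; exact le_max_right _ _
  have hC2le : C2 ≤ C2' := by rw [hC2']; exact le_max_left _ _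
  obtain ⟨KN, hKN⟩ : ∃ K : ℝ, K = 9 * (584 * Real.exp (9 / 2) + C84') := ⟨_, rfl⟩
  have hKN0 : 0 ≤ KN := by rw [hKN]; positivity
  obtain ⟨Lε, hLε⟩ : ∃ L : ℝ,
      L = KN * Real.exp 256 * (3 * (Nat.factorial 12 : ℝ) * 4 ^ 12 + 4 * C2') / (ε * π) :=
    ⟨_, rfl⟩
  obtain ⟨L0, hL0⟩ : ∃ L : ℝ, L = max (max 5 (5 * |c'| * π)) Lε := ⟨_, rfl⟩
  refine ⟨max (max D84 (max D₁ D₂)) ⌈Real.exp L0⌉₊, fun D _ χ hD hq hp hA a15 ha15 j hj => ?_⟩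
  -- thresholds
  have hDm : max D84 (max D₁ D₂) ≤ D := le_trans (le_max_left _ _) hD
  have hD84 : D84 ≤ D := le_trans (le_max_left _ _) hDm
  have hD₁ : D₁ ≤ D := le_trans (le_trans (le_max_left _ _) (le_max_right _ _)) hDm
  have hD₂ : D₂ ≤ D := le_trans (le_trans (le_max_right _ _) (le_max_right _ _)) hDm
  have hℓL0 : L0 ≤ ell D := le_ell_of_ceil_exp_le (le_trans (le_max_right _ _) hD)
  rw [hL0] at hℓL0
  have hℓ5 : 5 ≤ ell D := le_trans (le_trans (le_max_left _ _) (le_max_left _ _)) hℓL0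
  have hℓc : 5 * |c'| * π ≤ ell D := le_trans (le_trans (le_max_right _ _) (le_max_left _ _)) hℓL0
  have hℓε : Lε ≤ ell D := le_trans (le_max_right _ _) hℓL0
  have hℓ : 3 ≤ ell D := by linarith
  have h1 : 1 ≤ ell D := by linarith
  have h0 : 0 < ell D := by linarith
  have hlog1 : 1 ≤ Real.log D := h1
  have hlog3 : 3 ≤ Real.log D := hℓ
  -- `5|c′|α𝓛 ≤ 1`
  have hc5 : 5 * |c'| * alpha D * ell D ≤ 1 := by
    have hαℓ : alpha D * ell D = π * (ell D ^ 8)⁻¹ := Sec12D.alpha_mul_ell_eq hlog1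
    have h8 : ell D ≤ ell D ^ 8 := by
      calc ell D = ell D ^ 1 := (pow_one _).symm
        _ ≤ ell D ^ 8 := pow_le_pow_right₀ h1 (by norm_num)
    have h8pos : 0 < ell D ^ 8 := by positivity
    calc 5 * |c'| * alpha D * ell D = 5 * |c'| * π * (ell D ^ 8)⁻¹ := by
          rw [mul_assoc (5 * |c'|), hαℓ]; ring
      _ ≤ ell D ^ 8 * (ell D ^ 8)⁻¹ := by gcongr; exact hℓc.trans h8
      _ = 1 := by field_simp
  -- range facts
  obtain ⟨hTP3, hTP2, hP1N, hP1P, hW2⟩ := range_sizes hℓ5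
  have hT0 : 0 < bigT D := bigT_pos D
  have hT1 : 1 ≤ bigT D := by rw [bigT]; exact Real.one_le_exp (Real.rpow_nonneg h0.le _)
  have hP1pos : 0 < P1pp D := Sec12D.P1pp_pos hlog1
  obtain ⟨W, hW⟩ : ∃ W : ℝ, W = P1pp D / bigT D := ⟨_, rfl⟩
  rw [← hW] at hW2
  have hW1 : 1 ≤ W := by linarith
  have hWle : W ≤ P1pp D := by rw [hW]; exact div_le_self hP1pos.le hT1
  -- the three inputs at this `D`
  have H84D := H84 D χ hD84 hq hp hA
  have H1D := H1 D χ hD₁ hq hp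
  have H2D := H2 D χ hD₂ hq hp hA
  -- the range as a set of `n = dr`
  have hpN : ∀ n, rngBot D n → n < Nsupp D := by
    intro n hn
    have h : (n : ℝ) < Nsupp D := by
      calc (n : ℝ) ≤ P1pp D := hn
        _ < bigP D / bigT D ^ 2 := hP1N
        _ ≤ ⌈bigP D / bigT D ^ 2⌉₊ := Nat.le_ceil _
        _ = (Nsupp D : ℝ) := by rw [Nsupp]
    exact_mod_cast h
  classical
  set S : Finset ℕ := (Finset.Ico 1 (Nsupp D)).filter (fun n => rngBot D n) with hS
  have hSmem : ∀ n ∈ S, 1 ≤ n ∧ (n : ℝ) ≤ P1pp D := by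
    intro n hn
    rw [hS, Finset.mem_filter, Finset.mem_Ico] at hn
    exact ⟨hn.1.1, hn.2⟩
  -- the `m`-sum bound per `n` (two-valued)
  have hMb0 : ∀ n : ℕ, 0 ≤
      (if (n : ℝ) ≤ W then bigT D ^ (-(1 / 4 : ℝ)) else C2' * ell D ^ (2.2 : ℝ) / ell D ^ 9) := by
    intro n
    split_ifs
    · exact Real.rpow_nonneg hT0.le _
    · have : 0 ≤ ell D ^ (2.2 : ℝ) := Real.rpow_nonneg h0.le _
      positivity
  have hM : ∀ n ∈ S, ‖sum121 c' χ j n‖ ≤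
      (if (n : ℝ) ≤ W then bigT D ^ (-(1 / 4 : ℝ)) else C2' * ell D ^ (2.2 : ℝ) / ell D ^ 9) := by
    intro n hn
    obtain ⟨hn1, hnP⟩ := hSmem n hn
    split_ifs with hnW
    · exact H1D j hj n hn1 (by rw [hW] at hnW; exact hnW)
    · have h := H2D j hj n hn1 (by rw [hW] at hnW; exact not_le.mp hnW) hnP
      refine h.trans ?_
      change C2 * ell D ^ (2.2 : ℝ) / ell D ^ 9 ≤ C2' * ell D ^ (2.2 : ℝ) / ell D ^ 9
      have : 0 ≤ ell D ^ (2.2 : ℝ) := Real.rpow_nonneg h0.le _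
      gcongr
  -- the `n`-sum bound per `(n/r, r)`
  have hN : ∀ n ∈ S, ∀ r ∈ n.divisors,
      ‖nSum22 c' χ j (n / r) r‖ ≤ ((n : ℝ) / Nat.totient n) ^ 2 * (KN / ell D ^ 7) := by
    intro n hn r hr
    obtain ⟨hn1, hnP⟩ := hSmem n hn
    have hrn : r ∣ n := Nat.dvd_of_mem_divisors hr
    have hr1 : 1 ≤ r := Nat.pos_of_mem_divisors hr
    have hdr : n / r * r = n := Nat.div_mul_cancel hrn
    have hd1 : 1 ≤ n / r := Nat.div_pos (Nat.le_of_dvd hn1 hrn) hr1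
    have hdrR : ((n / r * r : ℕ) : ℝ) = n := by rw [hdr]
    have hn0 : (0 : ℝ) < n := by exact_mod_cast hn1
    have hn1' : (1 : ℝ) ≤ n := by exact_mod_cast hn1
    have hdrN : ((n / r * r : ℕ) : ℝ) < bigP D / bigT D ^ 2 := by
      rw [hdrR]; exact hnP.trans_lt hP1N
    have hdrP : ((n / r * r : ℕ) : ℝ) ≤ bigP D := by rw [hdrR]; exact hnP.trans hP1P
    have hy3T : bigT D < Skeleton.P3 D / ((n / r * r : ℕ) : ℝ) := by
      rw [hdrR, lt_div_iff₀ hn0]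
      calc bigT D * n ≤ bigT D * P1pp D := by gcongr
        _ < Skeleton.P3 D := hTP3
    have hy3P : Skeleton.P3 D / ((n / r * r : ℕ) : ℝ) < bigP D := by
      rw [hdrR]
      exact (div_le_self (zero_le_one.trans (one_lt_P3 hℓ).le) hn1').trans_lt (P3_lt_bigP hℓ)
    have hy2T : bigT D < Skeleton.P2 D / ((n / r * r : ℕ) : ℝ) := by
      rw [hdrR, lt_div_iff₀ hn0]
      calc bigT D * n ≤ bigT D * P1pp D := by gcongr
        _ < Skeleton.P2 D := hTP2
    have hy2P : Skeleton.P2 D / ((n / r * r : ℕ) : ℝ) < bigP D := by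
      rw [hdrR]
      exact (div_le_self (zero_le_one.trans (one_lt_P2 hℓ).le) hn1').trans_lt (P2_lt_bigP hℓ)
    have h6 := H84D j hj 6 (by simp) (n / r) r hd1 hr1 hdrN _ hy3T hy3P
    have h7 := H84D j hj 7 (by simp) (n / r) r hd1 hr1 hdrN _ hy2T hy2P
    have hw : ∀ {x : ℝ},
        x ≤ C84 * (ell D ^ 6)⁻¹ * (∏ q ∈ (n / r * r).primeFactors, (1 - (q : ℝ)⁻¹)⁻¹) ^ 2 →
          x ≤ C84' * (ell D ^ 6)⁻¹ * (∏ q ∈ (n / r * r).primeFactors, (1 - (q : ℝ)⁻¹)⁻¹) ^ 2 :=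
      fun hx => hx.trans (by gcongr)
    have key := norm_nSum22_le_of_rel c' χ hℓ hp hc5 hC84'0 j hd1 hr1 hdrP (hw h6) (hw h7)
    rw [hdr, ← hKN] at key
    calc ‖nSum22 c' χ j (n / r) r‖ ≤ ((n : ℝ) / Nat.totient n) ^ 2 * KN / ell D ^ 7 := key
      _ = ((n : ℝ) / Nat.totient n) ^ 2 * (KN / ell D ^ 7) := by ring
  -- per-`n` bound
  have hper : ∀ n ∈ S, ∑ r ∈ n.divisors,
      ‖((ArithmeticFunction.moebius r).natAbs : ℂ) * lamZero c' D j (n / r * r) /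
            (((n / r * r : ℕ) : ℂ) * (Nat.totient r : ℂ)) *
          (∑ m ∈ Finset.Ico 1 (Nsupp D), a15 (n / r * r * m) / (m : ℂ) ^ (1 - betaJ c' D j)) *
          (∑ n' ∈ Finset.Ico 1 (Nsupp D),
            a22 χ (n / r * r * n') * xiZero c' D j n' (n / r) r / (n' : ℂ))‖ ≤
      ((n : ℝ) / Nat.totient n) ^ 7 / n *
        (if (n : ℝ) ≤ W then bigT D ^ (-(1 / 4 : ℝ)) else C2' * ell D ^ (2.2 : ℝ) / ell D ^ 9) *
        (KN / ell D ^ 7) := by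
    intro n hn
    obtain ⟨hn1, hnP⟩ := hSmem n hn
    refine sum_divisors_norm_term_le c' j (by omega)
      (fun r => ∑ m ∈ Finset.Ico 1 (Nsupp D), a15 (n / r * r * m) / (m : ℂ) ^ (1 - betaJ c' D j))
      (fun r => ∑ n' ∈ Finset.Ico 1 (Nsupp D),
        a22 χ (n / r * r * n') * xiZero c' D j n' (n / r) r / (n' : ℂ))
      (hMb0 n) (fun r hr => ?_) (fun r hr => ?_)
    · have hdr : n / r * r = n := Nat.div_mul_cancel (Nat.dvd_of_mem_divisors hr)
      simp only [hdr]
      rw [mSum15_eq c' χ hlog3 j ha15 hn1, norm_mul]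
      calc ‖χ (n : ZMod D)‖ * ‖sum121 c' χ j n‖ ≤ 1 * ‖sum121 c' χ j n‖ := by
            gcongr; exact DirichletCharacter.norm_le_one χ _
        _ ≤ _ := by rw [one_mul]; exact hM n hn
    · rw [nSum22_eq_mul c' χ hq j (n / r) r, norm_mul]
      calc ‖χ ((n / r * r : ℕ) : ZMod D)‖ * ‖nSum22 c' χ j (n / r) r‖
          ≤ 1 * ‖nSum22 c' χ j (n / r) r‖ := by
            gcongr; exact DirichletCharacter.norm_le_one χ _
        _ ≤ _ := by rw [one_mul]; exact hN n hn r hr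
  -- the total
  have htot : ‖SjOn c' D j a15 (a22 χ) (rngBot D)‖ ≤
      bigT D ^ (-(1 / 4 : ℝ)) * (KN / ell D ^ 7) * (1 + Real.exp 256 * (1 + Real.log W)) +
        C2' * ell D ^ (2.2 : ℝ) / ell D ^ 9 * (KN / ell D ^ 7) *
          (Real.exp 256 * (3 + Real.log (P1pp D) - Real.log W)) := by
    rw [SjOn_bot_eq c' χ j a15 hpN, ← hS]
    refine (norm_sum_le _ _).trans ?_
    refine (Finset.sum_le_sum fun n hn => (norm_sum_le _ _).trans (hper n hn)).trans ?_
    rw [← Finset.sum_filter_add_sum_filter_not S (fun n : ℕ => (n : ℝ) ≤ W)]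
    have e1 : ∑ n ∈ S.filter (fun n : ℕ => (n : ℝ) ≤ W), ((n : ℝ) / Nat.totient n) ^ 7 / n *
        (if (n : ℝ) ≤ W then bigT D ^ (-(1 / 4 : ℝ)) else C2' * ell D ^ (2.2 : ℝ) / ell D ^ 9) *
        (KN / ell D ^ 7) =
        bigT D ^ (-(1 / 4 : ℝ)) * (KN / ell D ^ 7) *
          ∑ n ∈ S.filter (fun n : ℕ => (n : ℝ) ≤ W), ((n : ℝ) / Nat.totient n) ^ 7 / n := by
      rw [Finset.mul_sum]
      refine Finset.sum_congr rfl fun n hn => ?_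
      rw [Finset.mem_filter] at hn
      rw [if_pos hn.2]; ring
    have e2 : ∑ n ∈ S.filter (fun n : ℕ => ¬ (n : ℝ) ≤ W), ((n : ℝ) / Nat.totient n) ^ 7 / n *
        (if (n : ℝ) ≤ W then bigT D ^ (-(1 / 4 : ℝ)) else C2' * ell D ^ (2.2 : ℝ) / ell D ^ 9) *
        (KN / ell D ^ 7) =
        C2' * ell D ^ (2.2 : ℝ) / ell D ^ 9 * (KN / ell D ^ 7) *
          ∑ n ∈ S.filter (fun n : ℕ => ¬ (n : ℝ) ≤ W), ((n : ℝ) / Nat.totient n) ^ 7 / n := by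
      rw [Finset.mul_sum]
      refine Finset.sum_congr rfl fun n hn => ?_
      rw [Finset.mem_filter] at hn
      rw [if_neg hn.2]; ring
    rw [e1, e2]
    have hT4 : 0 ≤ bigT D ^ (-(1 / 4 : ℝ)) := Real.rpow_nonneg hT0.le _
    have h22 : 0 ≤ ell D ^ (2.2 : ℝ) := Real.rpow_nonneg h0.le _
    gcongr
    · exact sum_main_le S (fun n hn => (hSmem n hn).1) hW1
    · exact sum_window_le S hW2 hWle (fun n hn => (hSmem n hn).2)
  -- sizes of the logarithms
  have hlogT : Real.log (bigT D) = ell D ^ (1.1 : ℝ) := by rw [bigT, Real.log_exp]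
  have hlogW : Real.log W = Real.log (P1pp D) - ell D ^ (1.1 : ℝ) := by
    rw [hW, Real.log_div hP1pos.ne' hT0.ne', hlogT]
  obtain ⟨hlP0, hlP1, -⟩ := log_P1pp_bounds hℓ
  obtain ⟨h11, h1r⟩ := ell_rpow_facts h1
  have hpoly := poly_aux hℓ5
  have hsq0 : 0 ≤ ell D ^ 2 := by positivity
  have hL9 : Real.log (P1pp D) ≤ ell D ^ 9 := by linarith
  have hlogW9 : Real.log W ≤ ell D ^ 9 := by
    rw [hlogW]; linarith [Real.rpow_nonneg h0.le (1.1 : ℝ)]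
  have hlogW0 : 0 ≤ Real.log W := Real.log_nonneg hW1
  have hE1 : (1 : ℝ) ≤ Real.exp 256 := Real.one_le_exp (by norm_num)
  have hl9 : (1 : ℝ) ≤ ell D ^ 9 := one_le_pow₀ h1
  have hA : bigT D ^ (-(1 / 4 : ℝ)) * (KN / ell D ^ 7) * (1 + Real.exp 256 * (1 + Real.log W)) ≤
      Real.exp (-(ell D / 4)) * (KN / ell D ^ 7) * (3 * Real.exp 256 * ell D ^ 9) := by
    have hm : 1 + Real.exp 256 * (1 + Real.log W) ≤ 3 * Real.exp 256 * ell D ^ 9 := by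
      have a1 : 1 ≤ Real.exp 256 * ell D ^ 9 := one_le_mul_of_one_le_of_one_le hE1 hl9
      have a2 : Real.exp 256 * (1 + Real.log W) ≤ Real.exp 256 * (2 * ell D ^ 9) :=
        mul_le_mul_of_nonneg_left (by linarith) (by positivity)
      linarith
    have := bigT_rpow_neg_quarter_le h1 (D := D)
    gcongr
  have hB : C2' * ell D ^ (2.2 : ℝ) / ell D ^ 9 * (KN / ell D ^ 7) *
        (Real.exp 256 * (3 + Real.log (P1pp D) - Real.log W)) ≤
      C2' * ell D ^ 3 / ell D ^ 9 * (KN / ell D ^ 7) * (Real.exp 256 * (4 * ell D ^ 2)) := by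
    have hwin : 3 + Real.log (P1pp D) - Real.log W ≤ 4 * ell D ^ 2 := by
      rw [hlogW]
      have : (1 : ℝ) ≤ ell D ^ 2 := one_le_pow₀ h1
      linarith
    have := ell_rpow22_le h1 (D := D)
    have hwin0 : 0 ≤ 3 + Real.log (P1pp D) - Real.log W := by rw [hlogW]; linarith
    gcongr
  have hαeq : alpha D = π / ell D ^ 9 := (alpha_facts hℓ).2.1
  have hfin := closing hKN0 hC2'0 hε h1 (by rw [hLε] at hℓε; exact hℓε)
  calc ‖SjOn c' D j a15 (a22 χ) (rngBot D)‖ ≤ _ := htot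
    _ ≤ Real.exp (-(ell D / 4)) * (KN / ell D ^ 7) * (3 * Real.exp 256 * ell D ^ 9) +
        C2' * ell D ^ 3 / ell D ^ 9 * (KN / ell D ^ 7) * (Real.exp 256 * (4 * ell D ^ 2)) :=
        add_le_add hA hB
    _ = KN * Real.exp 256 * (3 * ell D ^ 2 * Real.exp (-(ell D / 4)) + 4 * C2' * (ell D ^ 11)⁻¹) := by
        field_simp
    _ ≤ ε * π / ell D ^ 9 := hfin
    _ = ε * alpha D := by rw [hαeq]; ring

/-- **The same edge from the printed (absolute) Lemma 8.4** `Skeleton.Lemma84 c′`, which implies the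
relative form (`Skeleton.lemma84Rel_of_lemma84`). [cite: Zhang2022LandauSiegel, §12 p. 73, tex L3688] -/
theorem low1522_of_lemma84 (c' : ℝ) (h84 : Lemma84 c') : Low1522 c' :=
  low1522_of_lemma84Rel c' (lemma84Rel_of_lemma84 h84)

end Main

end Literature.NumberTheory.LFunctions.Zhang2022.Typed.Sec12C
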